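import Mathlib
import HarnessLib
import Literature.MathematicalPhysics.QuantumFieldTheory.ConstructiveQFTWave0
import Literature.MathematicalPhysics.QuantumLattice.AbelianFieldTensor
import Literature.MathematicalPhysics.QuantumLattice.AbelianMagneticFlux
import Literature.MathematicalPhysics.QuantumLattice.AbelianBianchiIdentity
import Summits.Ventures.LatticeQCDFlow.Scaling.TopologicalCollar
import Summits.Ventures.LatticeQCDFlow.Scaling.FluxSectorCollar
import Summits.Ventures.LatticeQCDFlow.Scaling.FluxSmallSteps
import Summits.Ventures.LatticeQCDFlow.Scaling.SliceTwistWitness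
import Summits.Ventures.LatticeQCDFlow.Scaling.ThinSectorsConnected
import Summits.Ventures.LatticeQCDFlow.Scaling.TorusCochain
import Summits.Ventures.LatticeQCDFlow.Scaling.TorusPoincareLemma
import Summits.Ventures.LatticeQCDFlow.Scaling.MonopoleNumber

/-!
# `ε`-sectors in every dimension: the level sets of (monopole numbers, fluxes) — conjecture C10

HONEST FRAMING: exact (Metropolis-corrected) sampling algorithms for lattice gauge theory;
figures of merit are autocorrelation/cost numbers at stated couplings and volumes; no
continuum-physics claim.

Venture `LatticeQCDFlow` (cell pub-lqcd), topic `Scaling`, FANOUT row 29 (theory2, gen-23), item 113b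
(after 113a `Scaling/MonopoleNumber`, 112a/112b `Scaling/TorusCochain`, `Scaling/TorusPoincareLemma`).
NEW WORK; nothing here is cited as a fact.  LITERATURE STATUS (honest): for ADMISSIBLE fields
(`|F| < ε` in angle, `0 < ε < π/3`, any dimension) the statement is KNOWN IN PRINT — Lüscher, Nucl.
Phys. B 549 (1999) 295 [hep-lat/9811032], §2.2 and Lemma 7.4: the space of admissible abelian fields on
the periodic lattice is the disjoint union of its magnetic-flux sectors, each "a multi-dimensional torus
times a convex space", hence connected.  What is added here (every `d`, every `L ≥ 1`): the SAME
conclusion at EVERY chordal threshold `ε` once the flux label is refined by the DeGrand–Toussaint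
MONOPOLE NUMBERS of the cubes (which are not identically zero as soon as plaquette angles `≥ π/3` are
allowed, `d ≥ 3`); an explicit path inside the thin set; kernel-checked.  Item 110
(`Scaling/ThinSectorsConnected`) is the case `d = 2`, where there are no cubes.  Grade: formalisation of
a known mechanism plus a range extension; not a new theorem of physics.

THE STATEMENT (conjecture C10 (a)–(c) of the cell's THEORY-2 §4; C10 (d), the sharpness of the
threshold `ε = 1` in `d ≥ 3`, is not in this file).  `ThinSet d L ε` (113a) is the `ε`-thin set of
the metric tunnelling laws; its connected components are the `ε`-SECTORS an exact local sampler must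
tunnel between; `topCharge 0 μ ν W ∈ ℤ` (tree, `Scaling/FluxSectorCollar`) is Lüscher's flux through
the coordinate `(μ,ν)`-torus through the origin and `monopole W x ν ρ σ ∈ ℤ` (113a) the monopole
number of the cube at `x` spanned by `ν, ρ, σ`.
* (b) `mem_connectedComponentIn_thin_of_labels_eq` — for EVERY `ε`: two `ε`-thin configurations with
  the same monopole number in every cube and the same flux through every coordinate plane through
  `0` lie in the same connected component of `ThinSet d L ε`;
* (a)+(c) `mem_connectedComponentIn_thin_iff`, `connectedComponentIn_thin_eq_iff` — for `ε ≤ 2` the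
  `ε`-sectors are EXACTLY the joint level sets of (monopole numbers, fluxes) (the converse
  inclusions are 113a `monopole_eq_of_mem_connectedComponentIn` and the tree's
  `Flux.topCharge_eq_of_mem_connectedComponentIn`);
* (c) `mem_connectedComponentIn_thin_iff_of_le_one` — for `ε ≤ 1` (angles `< π/3`, Lüscher
  admissibility) the monopole numbers vanish identically and the `ε`-sectors are exactly the FLUX
  sectors, in every dimension (Lüscher's theorem, at the chordal threshold);
* `MonopoleSectorsC10` / `monopoleSectorsC10` — C10 (b) verbatim as a closed `Prop`, proved.

PROOF of (b) (`ε ≤ 2`; for `ε > 2` every configuration is thin and the exponentiated segment between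
any two lifts will do).  Lift `U = exp(ia)`, `U' = exp(ia')`; in every index pair
`curl a = F + 2πm`, `curl a' = F' + 2πm'` with INTEGER `2`-cochains `m, m'`, antisymmetric with zero
diagonal because `F, F'` are (no `−1` plaquettes).  `G = m' − m` is closed — its cube coboundary is
`(2π)⁻¹(cob F − cob F')`, the difference of the monopole numbers, `= 0` — and has zero periods — the
period of `m` through the `(μ,ν)`-torus through `x` is minus the flux charge `topCharge x μ ν U`
(`period_curl`, `period_eq_sum`, `magneticFlux`), equal charges at base `0` for `μ < ν`, antisymmetry
for `ν < μ`, and base-point independence of the periods of a closed cochain (`period_eq_period`) do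
the rest.  By the integer Poincaré lemma `TorusCochain.exists_curl_eq` (112b), `G = curl k` with `k`
INTEGER; replacing `a'` by `a' − 2πk` (the same `U'`) makes the integer parts equal, and along the
segment `a_t = (1−t)a + t a'` every plaquette of `exp(i a_t)` is `exp(i((1−t)F + tF'))`, at chordal
distance `≤ max(dist(P,1), dist(P',1)) < ε` from `1` (113a `dist_exp_lineComb_one_le`): a path inside
`ThinSet d L ε`, and `IsPreconnected.subset_connectedComponentIn` concludes.

No `sorry`, no new axioms, no `opaque`; standard axioms only.
-/

noncomputable section

namespace Summit.Ventures.LatticeQCDFlow.Theory2.Lattice.Flux.MonopoleSectors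

open Metric Set Filter Topology Real Finset
open Literature.MathematicalPhysics.QuantumFieldTheory Literature.MathematicalPhysics.QuantumLattice
open Summit.Ventures.LatticeQCDFlow.Theory2.Lattice.Flux.TorusCochain
open Summit.Ventures.LatticeQCDFlow.Theory2.Lattice.Flux.ThinSectors (abs_lineComb_le dist_exp_one_mono_abs)

variable {d L : ℕ}

/-! ## §5. Sectors are the level sets of (monopole numbers, fluxes) -/

variable [NeZero L]

/-- **Same labels ⇒ same `ε`-sector** (every `ε`, every `L ≥ 1`, every `d`).  Two `ε`-thin `U(1)`
configurations on `(ℤ/L)^d` with the same monopole number in every cube and the same flux through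
every coordinate plane through the origin lie in the same connected component of the `ε`-thin set.
[cite: Luscher1999AbelianChiral, §7] [folklore] -/
theorem mem_connectedComponentIn_thin_of_labels_eq {ε : ℝ} {U U' : GaugeConfig d L Circle}
    (hU : U ∈ ThinSet d L ε) (hU' : U' ∈ ThinSet d L ε)
    (hn : ∀ (x : Site d L) (ν ρ σ : Fin d), monopole U x ν ρ σ = monopole U' x ν ρ σ)
    (hQ : ∀ μ ν : Fin d, μ < ν → topCharge (0 : Site d L) μ ν U = topCharge (0 : Site d L) μ ν U') :
    U' ∈ connectedComponentIn (ThinSet d L ε) U := by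
  obtain ⟨a, ha⟩ := exists_lift U
  obtain ⟨a', ha'⟩ := exists_lift U'
  have hπ : (0 : ℝ) < 2 * π := by positivity
  by_cases hε : ε ≤ 2
  swap
  · -- `ε > 2`: every configuration is thin and the exponentiated segment joins `U` to `U'`
    rw [not_le] at hε
    set γ : ℝ → GaugeConfig d L Circle := fun t e => Circle.exp (a e + t * (a' e - a e)) with hγ
    have hγ0 : γ 0 = U := by
      funext e; show Circle.exp (a e + 0 * (a' e - a e)) = U e; rw [← ha e]; congr 1; ring
    have hγ1 : γ 1 = U' := by
      funext e; show Circle.exp (a e + 1 * (a' e - a e)) = U' e; rw [← ha' e]; congr 1; ring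
    have hpre : IsPreconnected (γ '' Icc 0 1) :=
      isPreconnected_Icc.image γ (continuous_expSegment a a').continuousOn
    exact hpre.subset_connectedComponentIn ⟨0, ⟨le_rfl, zero_le_one⟩, hγ0⟩
      (by rintro _ ⟨t, _, rfl⟩; exact mem_thinSet_of_two_lt hε _) ⟨1, ⟨zero_le_one, le_rfl⟩, hγ1⟩
  -- integer parts of the plaquette angles of the lifts
  choose m hm using fun x μ ν => exists_int_curl_eq ha x μ ν
  choose m' hm' using fun x μ ν => exists_int_curl_eq ha' x μ ν
  -- their difference is an antisymmetric closed 2-cochain with vanishing periods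
  set G : Site d L → Fin d → Fin d → ℤ := fun x μ ν => m' x μ ν - m x μ ν with hG
  have hFa := abelianFieldTensor_swap_of_thin hε hU
  have hFa' := abelianFieldTensor_swap_of_thin hε hU'
  have hmanti : ∀ x μ ν, ((m x ν μ : ℤ) : ℝ) = -(m x μ ν : ℤ) := fun x μ ν => by
    have h1 := hm x μ ν
    have h2 := hm x ν μ
    rw [curl_swap, hFa] at h2
    have : ((m x ν μ : ℝ) + m x μ ν) * (2 * π) = 0 := by linarith
    have h3 := (mul_eq_zero.mp this).resolve_right hπ.ne'
    linarith
  have hmanti' : ∀ x μ ν, ((m' x ν μ : ℤ) : ℝ) = -(m' x μ ν : ℤ) := fun x μ ν => by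
    have h1 := hm' x μ ν
    have h2 := hm' x ν μ
    rw [curl_swap, hFa'] at h2
    have : ((m' x ν μ : ℝ) + m' x μ ν) * (2 * π) = 0 := by linarith
    have h3 := (mul_eq_zero.mp this).resolve_right hπ.ne'
    linarith
  have hGanti : ∀ x μ ν, G x ν μ = -G x μ ν := fun x μ ν => by
    have h1 := hmanti x μ ν
    have h2 := hmanti' x μ ν
    have : ((m' x ν μ - m x ν μ : ℤ) : ℝ) = -((m' x μ ν - m x μ ν : ℤ) : ℝ) := by
      push_cast at h1 h2 ⊢; linarith
    exact_mod_cast this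
  have hmdiag : ∀ x μ, ((m x μ μ : ℤ) : ℝ) = 0 := fun x μ => by
    have h1 := hm x μ μ
    rw [curl_self, abelianFieldTensor_self, zero_add] at h1
    have := (mul_eq_zero.mp h1.symm).resolve_right hπ.ne'
    exact this
  have hmdiag' : ∀ x μ, ((m' x μ μ : ℤ) : ℝ) = 0 := fun x μ => by
    have h1 := hm' x μ μ
    rw [curl_self, abelianFieldTensor_self, zero_add] at h1
    have := (mul_eq_zero.mp h1.symm).resolve_right hπ.ne'
    exact this
  have hGdiag : ∀ x μ, G x μ μ = 0 := fun x μ => by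
    have : ((m' x μ μ - m x μ μ : ℤ) : ℝ) = 0 := by push_cast; rw [hmdiag, hmdiag', sub_zero]
    exact_mod_cast this
  -- closedness: the cube coboundary of the integer parts is minus the monopole number
  have hcobm : ∀ x ν ρ σ, ((cob m x ν ρ σ : ℤ) : ℝ) = -monopole U x ν ρ σ := fun x ν ρ σ => by
    have hc : cob (curl a) x ν ρ σ = 0 := cob_curl a x ν ρ σ
    have e1 := hm (x.shift ν) ρ σ; have e2 := hm x ρ σ; have e3 := hm (x.shift ρ) σ ν
    have e4 := hm x σ ν; have e5 := hm (x.shift σ) ν ρ; have e6 := hm x ν ρ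
    have key : ((cob m x ν ρ σ : ℤ) : ℝ) * (2 * π) = -cob (abelianFieldTensor U) x ν ρ σ := by
      simp only [cob] at hc ⊢
      push_cast
      linear_combination hc - e1 + e2 - e3 + e4 - e5 + e6
    rw [monopole, ← neg_div, eq_div_iff hπ.ne']
    exact key
  have hcobm' : ∀ x ν ρ σ, ((cob m' x ν ρ σ : ℤ) : ℝ) = -monopole U' x ν ρ σ := fun x ν ρ σ => by
    have hc : cob (curl a') x ν ρ σ = 0 := cob_curl a' x ν ρ σ
    have e1 := hm' (x.shift ν) ρ σ; have e2 := hm' x ρ σ; have e3 := hm' (x.shift ρ) σ ν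
    have e4 := hm' x σ ν; have e5 := hm' (x.shift σ) ν ρ; have e6 := hm' x ν ρ
    have key : ((cob m' x ν ρ σ : ℤ) : ℝ) * (2 * π) = -cob (abelianFieldTensor U') x ν ρ σ := by
      simp only [cob] at hc ⊢
      push_cast
      linear_combination hc - e1 + e2 - e3 + e4 - e5 + e6
    rw [monopole, ← neg_div, eq_div_iff hπ.ne']
    exact key
  have hGcob : ∀ x ν ρ σ, cob G x ν ρ σ = 0 := fun x ν ρ σ => by
    have h1 : ((cob G x ν ρ σ : ℤ) : ℝ) = 0 := by
      rw [hG, cob_sub]; push_cast; rw [hcobm, hcobm', hn]; ring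
    exact_mod_cast h1
  -- periods: the period of the integer parts is minus the flux charge
  have hmR : ∀ y α β, ((m y α β : ℤ) : ℝ) =
      curl a y α β / (2 * π) - abelianFieldTensor U y α β / (2 * π) := fun y α β => by
    rw [← sub_div, eq_div_iff hπ.ne', hm y α β]; ring
  have hmR' : ∀ y α β, ((m' y α β : ℤ) : ℝ) =
      curl a' y α β / (2 * π) - abelianFieldTensor U' y α β / (2 * π) := fun y α β => by
    rw [← sub_div, eq_div_iff hπ.ne', hm' y α β]; ring
  have hperm : ∀ x μ ν, period (fun y α β => ((m y α β : ℤ) : ℝ)) x μ ν = -topCharge x μ ν U :=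
    fun x μ ν => by
    rw [period_eq_sum]
    simp only [hmR, Finset.sum_sub_distrib, ← Finset.sum_div]
    rw [← period_eq_sum, period_curl, zero_div, zero_sub, topCharge, magneticFlux]
  have hperm' : ∀ x μ ν, period (fun y α β => ((m' y α β : ℤ) : ℝ)) x μ ν = -topCharge x μ ν U' :=
    fun x μ ν => by
    rw [period_eq_sum]
    simp only [hmR', Finset.sum_sub_distrib, ← Finset.sum_div]
    rw [← period_eq_sum, period_curl, zero_div, zero_sub, topCharge, magneticFlux]
  have hperR : ∀ x μ ν, ((period G x μ ν : ℤ) : ℝ) =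
      period (fun y α β => ((m' y α β : ℤ) : ℝ)) x μ ν -
        period (fun y α β => ((m y α β : ℤ) : ℝ)) x μ ν := fun x μ ν => by
    simp only [period, lineSum, hG]
    push_cast
    simp only [Finset.sum_sub_distrib]
  have hGper0 : ∀ μ ν, μ < ν → period G 0 μ ν = 0 := fun μ ν hμν => by
    have h1 : ((period G 0 μ ν : ℤ) : ℝ) = 0 := by rw [hperR, hperm, hperm', hQ μ ν hμν, sub_self]
    exact_mod_cast h1
  have hGper : ∀ x μ ν, period G x μ ν = 0 := by
    intro x μ ν
    rw [period_eq_period G hGdiag hGcob x 0 μ ν]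
    rcases lt_trichotomy μ ν with h | h | h
    · exact hGper0 μ ν h
    · subst h; simp [period, lineSum, hGdiag]
    · rw [period_swap_of_anti G hGanti, hGper0 ν μ h, neg_zero]
  -- the integer Poincaré lemma corrects the second lift to the same integer parts
  obtain ⟨k, hk⟩ := exists_curl_eq G hGanti hGdiag hGcob hGper
  obtain ⟨a'', ha''_def⟩ : ∃ a'' : Edge d L → ℝ, ∀ e, a'' e = a' e - (2 * π) * k e :=
    ⟨_, fun _ => rfl⟩
  have ha'' : ∀ e, Circle.exp (a'' e) = U' e := fun e => by
    rw [← ha' e, ha''_def]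
    exact Circle.exp_eq_exp.mpr ⟨-k e, by push_cast; ring⟩
  have hcurl'' : ∀ x μ ν, curl a'' x μ ν = abelianFieldTensor U' x μ ν + m x μ ν * (2 * π) :=
    fun x μ ν => by
    rw [show a'' = fun e => a' e - (2 * π) * k e from funext ha''_def, curl_sub_const_mul,
      hm' x μ ν, hk x μ ν, hG]
    push_cast; ring
  -- the segment between the two lifts, exponentiated, stays in the thin set
  set γ : ℝ → GaugeConfig d L Circle := fun t e => Circle.exp (a e + t * (a'' e - a e)) with hγ
  have hγ0 : γ 0 = U := by
    funext e; show Circle.exp (a e + 0 * (a'' e - a e)) = U e; rw [← ha e]; congr 1; ring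
  have hγ1 : γ 1 = U' := by
    funext e; show Circle.exp (a e + 1 * (a'' e - a e)) = U' e; rw [← ha'' e]; congr 1; ring
  have hγthin : ∀ t ∈ Icc (0 : ℝ) 1, γ t ∈ ThinSet d L ε := by
    rintro t ht ⟨x, ⟨⟨μ, ν⟩, hμν⟩⟩
    show dist (plaquetteHolonomy (γ t) x μ ν) 1 < ε
    have hp : plaquetteHolonomy (γ t) x μ ν = Circle.exp (abelianFieldTensor U x μ ν +
        t * (abelianFieldTensor U' x μ ν - abelianFieldTensor U x μ ν)) := by
      rw [hγ, plaquetteHolonomy_exp, curl_lineComb, hm, hcurl'']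
      exact Circle.exp_eq_exp.mpr ⟨m x μ ν, by ring⟩
    rw [hp]
    exact (dist_exp_lineComb_one_le U U' x μ ν ht).trans_lt
      (max_lt (hU ⟨x, ⟨(μ, ν), hμν⟩⟩) (hU' ⟨x, ⟨(μ, ν), hμν⟩⟩))
  have hpre : IsPreconnected (γ '' Icc 0 1) :=
    isPreconnected_Icc.image γ (continuous_expSegment a a'').continuousOn
  exact hpre.subset_connectedComponentIn ⟨0, ⟨le_rfl, zero_le_one⟩, hγ0⟩
    (by rintro _ ⟨t, ht, rfl⟩; exact hγthin t ht) ⟨1, ⟨zero_le_one, le_rfl⟩, hγ1⟩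

/-- **The `ε`-sectors are the joint level sets of the monopole numbers and the fluxes** (`ε ≤ 2`,
every `d`, every `L ≥ 1`). [cite: Luscher1999AbelianChiral, §7] [folklore] -/
theorem mem_connectedComponentIn_thin_iff {ε : ℝ} (hε : ε ≤ 2) {U U' : GaugeConfig d L Circle}
    (hU : U ∈ ThinSet d L ε) (hU' : U' ∈ ThinSet d L ε) :
    U' ∈ connectedComponentIn (ThinSet d L ε) U ↔
      (∀ (x : Site d L) (ν ρ σ : Fin d), monopole U' x ν ρ σ = monopole U x ν ρ σ) ∧
        ∀ μ ν : Fin d, μ < ν → topCharge (0 : Site d L) μ ν U' = topCharge (0 : Site d L) μ ν U :=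
  ⟨fun h => ⟨fun x ν ρ σ => monopole_eq_of_mem_connectedComponentIn hε h x ν ρ σ,
      fun _ _ hμν => topCharge_eq_of_mem_connectedComponentIn hε 0 hμν h⟩,
    fun h => mem_connectedComponentIn_thin_of_labels_eq hU hU' (fun x ν ρ σ => (h.1 x ν ρ σ).symm)
      fun μ ν hμν => (h.2 μ ν hμν).symm⟩

/-- **Below the chordal threshold `1` the `ε`-sectors are exactly the flux sectors, in every
dimension**: there the monopole numbers vanish identically, so two thin configurations lie in the
same connected component of the thin set iff they have the same flux through every coordinate plane.
[cite: Luscher1999AbelianChiral, §7] [folklore] -/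
theorem mem_connectedComponentIn_thin_iff_of_le_one {ε : ℝ} (hε : ε ≤ 1)
    {U U' : GaugeConfig d L Circle} (hU : U ∈ ThinSet d L ε) (hU' : U' ∈ ThinSet d L ε) :
    U' ∈ connectedComponentIn (ThinSet d L ε) U ↔
      ∀ μ ν : Fin d, μ < ν → topCharge (0 : Site d L) μ ν U' = topCharge (0 : Site d L) μ ν U := by
  rw [mem_connectedComponentIn_thin_iff (hε.trans one_le_two) hU hU']
  exact ⟨fun h => h.2, fun h => ⟨fun x ν ρ σ => by
    rw [monopole_eq_zero_of_thin hε hU, monopole_eq_zero_of_thin hε hU'], h⟩⟩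

/-- **Sector equality is label equality** (`ε ≤ 2`). [folklore] -/
theorem connectedComponentIn_thin_eq_iff {ε : ℝ} (hε : ε ≤ 2) {U U' : GaugeConfig d L Circle}
    (hU : U ∈ ThinSet d L ε) (hU' : U' ∈ ThinSet d L ε) :
    connectedComponentIn (ThinSet d L ε) U = connectedComponentIn (ThinSet d L ε) U' ↔
      (∀ (x : Site d L) (ν ρ σ : Fin d), monopole U x ν ρ σ = monopole U' x ν ρ σ) ∧
        ∀ μ ν : Fin d, μ < ν → topCharge (0 : Site d L) μ ν U = topCharge (0 : Site d L) μ ν U' := by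
  constructor
  · intro h
    have hU'mem : U' ∈ connectedComponentIn (ThinSet d L ε) U := by
      rw [h]; exact mem_connectedComponentIn hU'
    obtain ⟨h1, h2⟩ := (mem_connectedComponentIn_thin_iff hε hU hU').mp hU'mem
    exact ⟨fun x ν ρ σ => (h1 x ν ρ σ).symm, fun μ ν hμν => (h2 μ ν hμν).symm⟩
  · intro h
    exact connectedComponentIn_eq (mem_connectedComponentIn_thin_of_labels_eq hU hU' h.1 h.2)

/-- Conjecture C10(b) of the cell's THEORY-2 §4 (monopole sectors), in the form: on the `ε`-thin set
(`0 < ε < 2`) of `U(1)` lattice gauge fields on `(ℤ/L)^d`, equal DeGrand–Toussaint monopole numbers in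
every cube and equal fluxes through the coordinate planes through the origin imply the two
configurations lie in the same connected component. [folklore] -/
def MonopoleSectorsC10 (d L : ℕ) [NeZero L] : Prop :=
  ∀ ε : ℝ, 0 < ε → ε < 2 → ∀ U U' : GaugeConfig d L Circle, U ∈ ThinSet d L ε → U' ∈ ThinSet d L ε →
    (∀ (x : Site d L) (ν ρ σ : Fin d), monopole U x ν ρ σ = monopole U' x ν ρ σ) →
    (∀ μ ν : Fin d, μ < ν → topCharge (0 : Site d L) μ ν U = topCharge (0 : Site d L) μ ν U') →
      U' ∈ connectedComponentIn (ThinSet d L ε) U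

/-- **C10(b) holds** in every dimension `d` and for every `L ≥ 1` (the hypotheses `0 < ε < 2` are
not needed). [folklore] -/
theorem monopoleSectorsC10 (d L : ℕ) [NeZero L] : MonopoleSectorsC10 d L :=
  fun _ _ _ _ _ hU hU' hn hQ => mem_connectedComponentIn_thin_of_labels_eq hU hU' hn hQ

end Summit.Ventures.LatticeQCDFlow.Theory2.Lattice.Flux.MonopoleSectors

end
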